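/-
COR-CM (cell pub-hodgecm2) — TEAM hComp (coordinator ruling 2026-08-21T18:44:30Z), seat hcomp-compare-1, table row C1 (part C2f):
COMPARISON MAPS 1, Liu's signature `(p_τ, q_τ)` of the tree's hermitian 3-space.  Count-neutral (no BINDER-OWNERS row, no hypothesis
binder); HC_CM is NOT proved and nothing here bears on it.
-/
import Summits.HodgeConjecture.CorCM.B01.Transposition.HComp.HermSpaceCompare
import Literature.NumberTheory.QuadraticForms.LandherrHermitianSimilitude
import HarnessLib

/-!
# COR-CM / hComp — Liu's subspace-counting signature of the tree's `HermSpace3` is `(2,1)` at `ι₁` and `(3,0)` elsewhere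

Companion of `HComp/HermSpaceCompare.lean` (§0–§2 there: the field dictionary, Def. C.4's matrix signature, Liu's REAL hermitian
space `V.toLiu : AppendixC.HermSpace L⁺ L` on `L³` and the identification of the unitary groups).  Here §3: typer 1's
(`Liu2021/AppendixC/DefC1toC3.lean`) SUBSPACE-COUNTING signature `HermSpace.sig τ = (posIndex τ, negIndex τ)` — «`(p_τ, q_τ)`, the
signature of `V ⊗_{F,τ} ℝ`» of [Liu2021] App. C l. 4558, typed (READING R5 there) as the largest dimensions of `E`-subspaces on
which `x ↦ τ(Tr_{E/F} (x,x)_V)` is positive, resp. negative — computed for the tree's `V : HermSpace3 L ι₁` read as `V.toLiu`: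

* §3.1 `toLiu_isPosAt_iff` / `toLiu_isNegAt_iff`: for `τ' ∈ Φ_E` above `τ`, `IsPosAt τ x ↔ 0 < Re τ'((x,x))` (trace bridge
  `τ(Tr (x,x)) = 2 Re τ'((x,x))`, `restr_trace_liuForm_self`), and `τ'((x,y)) = (τ'y)ᴴ · Hm^{τ'} · τ'x` (`embedding_liuForm`);
* §3.2 `finrank_add_finrank_le_three`: a `τ'`-positive and a `τ'`-negative `L`-subspace of `L³` meet in `0`, so their dimensions
  add up to at most `3`;
* §3.3 `exists_pos_plane_neg_line`: at the place of `ι₁` an explicit positive PLANE and negative LINE, read off an `L`-rational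
  orthogonal basis (Landherr, tree `hermitianMatrix_congruent_diagonal`) whose diagonal has exactly two `ι₁`-positive entries
  (Sylvester at `ι₁`, tree `HermSpace3.card_pos_eigenvalues_of_mk_eq` + `Landherr.card_pos_eigenvalues_eq_posCount`); off the place
  of `ι₁` every non-zero vector is positive (`re_embedding_liuForm_pos_of_mk_ne`, tree `posDef_of_ne`);
* §3.4 **`toLiu_sig_restr : V.toLiu.sig (restr L⁺ L ι₁) = (2, 1)`**, **`toLiu_sig_of_ne : τ ≠ restr L⁺ L ι₁ → V.toLiu.sig τ = (3, 0)`**,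
  hence **`toLiu_isSignatureN1At : V.toLiu.IsSignatureN1At (restr L⁺ L ι₁)`** — the hypothesis of [Liu2021] Rem. C.2 (l. 4603,
  «`V` has signature `(n−1,1)` at `τ` and `(n,0)` at other places») for the tree's `V`, i.e. the REAL field `sig_eq` of typer 1's
  carrier structure `HermSpace.ShimuraSystem V.toLiu ι₁` for Liu's `{Sh(G, h_{V,ι₁})_K}_K`.

Theorems only; nothing cited as a record; T5: n/a (no hypothesis binder).  References: [Liu2021] App. C l. 4558, 4573, Rem. C.2
l. 4602–4603; W. Landherr, Abh. Math. Sem. Hamburg 11 (1936) (orthogonal bases of hermitian forms over CM fields, via the tree).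
-/

noncomputable section

open scoped Matrix ComplexOrder
open NumberField
open Literature.NumberTheory.Automorphic
open Literature.NumberTheory.Automorphic.Liu2021.AppendixC
open Literature.NumberTheory.QuadraticForms
open Literature.AlgebraicGeometry.ShimuraVarieties

namespace Summit.HodgeConjecture.CorCM

namespace HermSpace3

variable {L : CMField} {ι₁ : L →+* ℂ} (V : HermSpace3 L ι₁)

/-! ### §3.1  Liu's `τ`-positivity through a complex embedding above `τ` -/

/-- Liu's form as a dot product: `(x, y) = c(y) · (Hm x)`. [cite: Liu2021, App. C l. 4558] -/
theorem liuForm_eq_dotProduct (x y : Fin 3 → L) :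
    V.liuForm x y = (fun i => cmConjRingHom L (y i)) ⬝ᵥ (V.Hm *ᵥ x) := by
  simp only [liuForm_apply, dotProduct, Matrix.mulVec, Finset.mul_sum, mul_assoc]

/-- **Complexification at an embedding**: `τ'((x, y)) = (τ'y)ᴴ · τ'(Hm) · τ'x` — the value of Liu's form read in `ℂ`
through `τ' ∈ Φ_E` is the complex hermitian form of the matrix `Hm^{τ'}` (l. 4573 «identify `V ⊗_{E,τ^-} ℂ` with `ℂ^{⊕n}`»).
[cite: Liu2021, App. C l. 4573] -/
theorem embedding_liuForm (τ' : L →+* ℂ) (x y : Fin 3 → L) :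
    τ' (V.liuForm x y) = star (τ' ∘ y) ⬝ᵥ ((V.Hm.map τ') *ᵥ (τ' ∘ x)) := by
  rw [liuForm_eq_dotProduct, RingHom.map_dotProduct]
  have h1 : (τ' ∘ fun i => cmConjRingHom L (y i)) = star (τ' ∘ y) := by
    funext i
    simp only [Function.comp_apply, Pi.star_apply, Complex.star_def]
    exact embedding_cmConjRingHom L τ' (y i)
  have h2 : (τ' ∘ (V.Hm *ᵥ x)) = (V.Hm.map τ') *ᵥ (τ' ∘ x) := by
    funext i
    exact RingHom.map_mulVec τ' V.Hm x i
  rw [h1, h2]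

/-- `(x, x)` is fixed by `c` (the form is hermitian), i.e. lies in `L⁺`. [cite: Liu2021, App. C l. 4558] -/
theorem cmConjRingHom_liuForm_self (x : Fin 3 → L) : cmConjRingHom L (V.liuForm x x) = V.liuForm x x :=
  (V.toLiu.form_herm x x).symm

/-- **The trace bridge**: for `τ' ∈ Φ_E` above `τ = π(τ') ∈ Φ_F`, Liu's real number `τ(Tr_{E/F} (x, x)_V)` (typer 1's READING R5
behind `IsPosAt` / `IsNegAt`) is `2 · Re τ'((x, x))`. [cite: Liu2021, App. C l. 4558] -/
theorem restr_trace_liuForm_self (τ' : L →+* ℂ) (x : Fin 3 → L) :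
    (restr (maximalRealSubfield L) L τ'
        (Algebra.trace (maximalRealSubfield L) L (V.liuForm x x)) : ℝ) = 2 * (τ' (V.liuForm x x)).re := by
  set z := V.liuForm x x with hz
  have hmem : z ∈ maximalRealSubfield L :=
    (IsCMField.complexConj_eq_self_iff (K := L) z).mp (V.cmConjRingHom_liuForm_self x)
  set a : maximalRealSubfield L := ⟨z, hmem⟩ with ha
  have haz : algebraMap (maximalRealSubfield L) L a = z := rfl
  have htr : Algebra.trace (maximalRealSubfield L) L z = 2 • a := by
    rw [← haz, Algebra.trace_algebraMap, Algebra.IsQuadraticExtension.finrank_eq_two (maximalRealSubfield L) L]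
  have hre : (τ' z).re = restr (maximalRealSubfield L) L τ' a := by
    rw [← haz, CMField.liesAbove_restr τ' a, Complex.ofReal_re]
  rw [htr, map_nsmul, nsmul_eq_mul, hre]
  norm_num

/-- **Liu's «`τ`-positive» ↔ positivity of the complex hermitian value**: `IsPosAt τ x ↔ 0 < Re τ'((x,x))` for any `τ'`
above `τ`. [cite: Liu2021, App. C l. 4558] -/
theorem toLiu_isPosAt_iff (τ' : L →+* ℂ) (x : Fin 3 → L) :
    V.toLiu.IsPosAt (restr (maximalRealSubfield L) L τ') x ↔ 0 < (τ' (V.liuForm x x)).re := by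
  change 0 < (restr (maximalRealSubfield L) L τ' (Algebra.trace (maximalRealSubfield L) L (V.liuForm x x)) : ℝ) ↔ _
  rw [restr_trace_liuForm_self]
  constructor
  · intro h; linarith
  · intro h; linarith

/-- `IsNegAt τ x ↔ Re τ'((x,x)) < 0` for any `τ'` above `τ`. [cite: Liu2021, App. C l. 4558] -/
theorem toLiu_isNegAt_iff (τ' : L →+* ℂ) (x : Fin 3 → L) :
    V.toLiu.IsNegAt (restr (maximalRealSubfield L) L τ') x ↔ (τ' (V.liuForm x x)).re < 0 := by
  change (restr (maximalRealSubfield L) L τ' (Algebra.trace (maximalRealSubfield L) L (V.liuForm x x)) : ℝ) < 0 ↔ _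
  rw [restr_trace_liuForm_self]
  constructor
  · intro h; linarith
  · intro h; linarith

/-! ### §3.2  Positive and negative subspaces cannot meet: the dimension bound -/

/-- If the form is `τ'`-positive on `P ∖ 0` and `τ'`-negative on `W ∖ 0` (two `L`-subspaces of `L³`), then
`dim P + dim W ≤ 3`: they meet in `0` only. [folklore] -/
theorem finrank_add_finrank_le_three (τ' : L →+* ℂ) (P W : Submodule L (Fin 3 → L))
    (hP : ∀ x ∈ P, x ≠ 0 → 0 < (τ' (V.liuForm x x)).re) (hW : ∀ x ∈ W, x ≠ 0 → (τ' (V.liuForm x x)).re < 0) :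
    Module.finrank L P + Module.finrank L W ≤ 3 := by
  have hinf : P ⊓ W = ⊥ := by
    rw [Submodule.eq_bot_iff]
    intro x hx
    by_contra hne
    exact lt_asymm (hP x hx.1 hne) (hW x hx.2 hne)
  have h := Submodule.finrank_sup_add_finrank_inf_eq P W
  rw [hinf, finrank_bot, add_zero] at h
  have hle : Module.finrank L ↥(P ⊔ W) ≤ Module.finrank L (Fin 3 → L) := Submodule.finrank_le _
  rw [Module.finrank_fin_fun] at hle
  omega

/-! ### §3.3  An `L`-rational orthogonal basis (Landherr) and the explicit positive plane / negative line at `ι₁` -/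

/-- Liu's form in the coordinates of a change of basis `G`: `(Gu, Gv) = c(v) · (ᵗ(cG) · Hm · G) · u`.
[cite: Liu2021, App. C l. 4558] -/
theorem liuForm_mulVec (G : Matrix (Fin 3) (Fin 3) L) (u v : Fin 3 → L) :
    V.liuForm (G *ᵥ u) (G *ᵥ v) =
      (fun i => cmConjRingHom L (v i)) ⬝ᵥ (((G.map (cmConjRingHom L))ᵀ * V.Hm * G) *ᵥ u) := by
  rw [liuForm_eq_dotProduct]
  have h1 : (fun i => cmConjRingHom L ((G *ᵥ v) i)) = (G.map (cmConjRingHom L)) *ᵥ (fun i => cmConjRingHom L (v i)) := by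
    funext i
    exact RingHom.map_mulVec (cmConjRingHom L) G v i
  rw [h1, ← Matrix.vecMul_transpose, ← Matrix.dotProduct_mulVec, Matrix.mulVec_mulVec, Matrix.mulVec_mulVec]

/-- In an orthogonal basis `ᵗ(cG) · Hm · G = diag d` the form is diagonal: `(Gu, Gu) = Σ c(uᵢ) dᵢ uᵢ`, so at an
embedding `τ'`: `Re τ'((Gu, Gu)) = Σᵢ Re τ'(dᵢ) · |τ'(uᵢ)|²` (Landherr's `realQ`). [folklore] -/
theorem re_embedding_liuForm_mulVec_of_diagonal {G : Matrix (Fin 3) (Fin 3) L} {d : Fin 3 → L}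
    (e : (G.map (cmConjRingHom L))ᵀ * V.Hm * G = Matrix.diagonal d) (τ' : L →+* ℂ) (u : Fin 3 → L) :
    (τ' (V.liuForm (G *ᵥ u) (G *ᵥ u))).re = Landherr.realQ (τ' ∘ d) (τ' ∘ u) := by
  rw [liuForm_mulVec, e, RingHom.map_dotProduct, ← Landherr.re_star_dotProduct_diagonal_mulVec]
  congr 2
  · funext i
    simp only [Function.comp_apply, Pi.star_apply, Complex.star_def]
    exact embedding_cmConjRingHom L τ' (u i)
  · funext i
    rw [Function.comp_apply, RingHom.map_mulVec, Matrix.diagonal_map (map_zero τ')]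
    rfl

/-- `realQ` is positive on a non-zero vector supported on indices with positive coefficients. [folklore] -/
theorem realQ_pos_of_support {d w : Fin 3 → ℂ} {k : Fin 3} (hd : ∀ i, i ≠ k → 0 < (d i).re) (hwk : w k = 0)
    (hw : w ≠ 0) : 0 < Landherr.realQ d w := by
  unfold Landherr.realQ
  obtain ⟨i₀, hi₀⟩ : ∃ i, w i ≠ 0 := Function.ne_iff.mp hw
  have hi₀k : i₀ ≠ k := fun h => hi₀ (h ▸ hwk)
  apply Finset.sum_pos'
  · intro i _
    by_cases hik : i = k
    · subst hik; simp [hwk]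
    · exact mul_nonneg (hd i hik).le (sq_nonneg _)
  · exact ⟨i₀, Finset.mem_univ _, mul_pos (hd i₀ hi₀k) (by positivity)⟩

/-- `realQ d (a · e_k) = Re d_k · |a|²`. [folklore] -/
theorem realQ_single (d : Fin 3 → ℂ) (k : Fin 3) (a : ℂ) :
    Landherr.realQ d (Pi.single k a) = (d k).re * ‖a‖ ^ 2 := by
  unfold Landherr.realQ
  rw [Finset.sum_eq_single k]
  · simp
  · intro i _ hik
    simp [Pi.single_eq_of_ne hik]
  · intro h; exact absurd (Finset.mem_univ k) h

/-- Multiplication by an invertible matrix is an injective linear endomorphism of `L³`. [folklore] -/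
theorem mulVec_injective_of_det_ne_zero {G : Matrix (Fin 3) (Fin 3) L} (hG : G.det ≠ 0) :
    Function.Injective (Matrix.toLin' G) := by
  intro u v h
  rw [Matrix.toLin'_apply, Matrix.toLin'_apply] at h
  have h0 : G *ᵥ (u - v) = 0 := by rw [Matrix.mulVec_sub, h, sub_self]
  exact sub_eq_zero.mp (Matrix.eq_zero_of_mulVec_eq_zero hG h0)

/-- The coordinate hyperplane `{u | u k = 0}` of `L³` has dimension `2`. [folklore] -/
theorem finrank_ker_proj (k : Fin 3) :
    Module.finrank L (LinearMap.ker (LinearMap.proj k : (Fin 3 → L) →ₗ[L] L)) = 2 := by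
  have h := LinearMap.finrank_range_add_finrank_ker (LinearMap.proj k : (Fin 3 → L) →ₗ[L] L)
  have hr : LinearMap.range (LinearMap.proj k : (Fin 3 → L) →ₗ[L] L) = ⊤ := by
    rw [LinearMap.range_eq_top]
    intro a
    exact ⟨Pi.single k a, by simp⟩
  rw [hr, finrank_top, Module.finrank_self, Module.finrank_fin_fun] at h
  omega

/-- **At the place of `ι₁` there is a `2`-dimensional `L`-subspace of `V(τ₁) = L³` on which Liu's form is `τ₁`-positive
definite and a `1`-dimensional one on which it is `τ₁`-negative definite** — read off an `L`-rational orthogonal basis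
(Landherr, tree `hermitianMatrix_congruent_diagonal`) whose diagonal has exactly two `ι₁`-positive entries (Sylvester at `ι₁`,
tree `HermSpace3.card_pos_eigenvalues_of_mk_eq`). [folklore] -/
theorem exists_pos_plane_neg_line {τ' : L →+* ℂ} (hτ' : InfinitePlace.mk τ' = InfinitePlace.mk ι₁) :
    (∃ P : Submodule L (Fin 3 → L), Module.finrank L P = 2 ∧ ∀ x ∈ P, x ≠ 0 → 0 < (τ' (V.liuForm x x)).re) ∧
    (∃ W : Submodule L (Fin 3 → L), Module.finrank L W = 1 ∧ ∀ x ∈ W, x ≠ 0 → (τ' (V.liuForm x x)).re < 0) := by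
  classical
  -- Landherr: an `L`-rational orthogonal basis
  obtain ⟨g, d, hd, hd0, e⟩ :=
    hermitianMatrix_congruent_diagonal L V.Hm V.transpose_map_complexConj V.det_ne_zero
  have e' : ((g : Matrix (Fin 3) (Fin 3) L).map (cmConjRingHom L))ᵀ * V.Hm * (g : Matrix (Fin 3) (Fin 3) L) =
      Matrix.diagonal d := by
    rw [← Matrix.transpose_map]; exact e
  have eL : Landherr.conjTranspose L (g : Matrix (Fin 3) (Fin 3) L) * V.Hm * (g : Matrix (Fin 3) (Fin 3) L) =
      Matrix.diagonal d := e
  have hgdet : ((g : Matrix (Fin 3) (Fin 3) L)).det ≠ 0 := by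
    have : IsUnit ((g : Matrix (Fin 3) (Fin 3) L)).det := (Matrix.isUnits_det_units g)
    exact this.ne_zero
  -- Sylvester at the place of `ι₁`: exactly two `τ'`-positive diagonal entries
  have hcount : Landherr.posCount L τ' d = 2 := by
    rw [← Landherr.card_pos_eigenvalues_eq_posCount L V.transpose_map_complexConj (Matrix.isUnits_det_units g) eL τ']
    exact V.card_pos_eigenvalues_of_mk_eq hτ'
  -- the non-positive index `k`
  have hnot : ¬ ∀ k : Fin 3, 0 < (τ' (d k)).re := fun h => by
    have h3 : Landherr.posCount L τ' d = Fintype.card (Fin 3) := (Landherr.posCount_eq_card_iff L τ' d).mpr h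
    rw [Fintype.card_fin] at h3
    omega
  obtain ⟨k, hk⟩ := not_forall.mp hnot
  -- every other index is positive (there are exactly two positive ones among three)
  have hpos : ∀ i, i ≠ k → 0 < (τ' (d i)).re := by
    intro i hik
    by_contra hi
    have hsub : (Finset.univ.filter fun j : Fin 3 => 0 < (τ' (d j)).re) ⊆ (Finset.univ.erase k).erase i := by
      intro j hj
      rw [Finset.mem_filter] at hj
      rw [Finset.mem_erase, Finset.mem_erase]
      refine ⟨fun h => hi (h ▸ hj.2), fun h => hk (h ▸ hj.2), Finset.mem_univ _⟩
    have hcard := Finset.card_le_card hsub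
    rw [Finset.card_erase_of_mem (Finset.mem_erase.mpr ⟨hik, Finset.mem_univ _⟩),
      Finset.card_erase_of_mem (Finset.mem_univ _), Finset.card_univ, Fintype.card_fin] at hcard
    change Landherr.posCount L τ' d ≤ 3 - 1 - 1 at hcard
    omega
  -- `τ'(d k)` is a non-zero real, hence negative
  have hneg : (τ' (d k)).re < 0 := by
    have hreal : (τ' (d k)).im = 0 := by
      have h1 : starRingEnd ℂ (τ' (d k)) = τ' (d k) := by
        rw [← embedding_cmConjRingHom L τ' (d k)]
        exact congrArg τ' (hd k)
      have := congrArg Complex.im h1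
      rw [Complex.conj_im] at this
      linarith
    have hne : (τ' (d k)).re ≠ 0 := by
      intro h0
      apply hd0 k
      have : τ' (d k) = 0 := Complex.ext h0 hreal
      exact (map_eq_zero τ').mp this
    rcases lt_trichotomy (τ' (d k)).re 0 with h | h | h
    · exact h
    · exact absurd h hne
    · exact absurd h hk
  set G : Matrix (Fin 3) (Fin 3) L := (g : Matrix (Fin 3) (Fin 3) L) with hGdef
  refine ⟨⟨(LinearMap.ker (LinearMap.proj k : (Fin 3 → L) →ₗ[L] L)).map (Matrix.toLin' G), ?_, ?_⟩,
    ⟨(L ∙ (G *ᵥ Pi.single k 1)), ?_, ?_⟩⟩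
  · -- dimension `2`
    exact (LinearEquiv.finrank_eq
      (Submodule.equivMapOfInjective _ (mulVec_injective_of_det_ne_zero hgdet) _)).symm.trans
        (finrank_ker_proj (L := L) k)
  · -- positivity on the plane
    rintro x hx hx0
    obtain ⟨u, hu, rfl⟩ := Submodule.mem_map.mp hx
    rw [LinearMap.mem_ker, LinearMap.proj_apply] at hu
    rw [Matrix.toLin'_apply] at hx0 ⊢
    rw [V.re_embedding_liuForm_mulVec_of_diagonal e' τ' u]
    have hu0 : u ≠ 0 := by rintro rfl; exact hx0 (Matrix.mulVec_zero _)
    refine realQ_pos_of_support (k := k) (fun i hik => hpos i hik) (by simp [hu]) ?_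
    intro h
    apply hu0
    funext i
    have := congrFun h i
    simpa using this
  · -- dimension `1`
    apply finrank_span_singleton
    intro h0
    have := Matrix.eq_zero_of_mulVec_eq_zero hgdet h0
    exact (one_ne_zero (α := L)) (by simpa using congrFun this k)
  · -- negativity on the line
    intro x hx hx0
    obtain ⟨a, rfl⟩ := Submodule.mem_span_singleton.mp hx
    have ha : a ≠ 0 := by rintro rfl; exact hx0 (zero_smul _ _)
    have hxa : a • (G *ᵥ Pi.single k 1) = G *ᵥ Pi.single k a := by
      rw [← Matrix.mulVec_smul]
      congr 1
      funext i
      by_cases hik : i = k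
      · subst hik; simp
      · simp [Pi.single_eq_of_ne hik]
    rw [hxa, V.re_embedding_liuForm_mulVec_of_diagonal e' τ' (Pi.single k a)]
    have hsingle : (τ' ∘ Pi.single k a : Fin 3 → ℂ) = Pi.single k (τ' a) := by
      funext i
      by_cases hik : i = k
      · subst hik; simp
      · simp [Pi.single_eq_of_ne hik]
    rw [hsingle, realQ_single]
    have hτa : 0 < ‖τ' a‖ ^ 2 := by
      have : τ' a ≠ 0 := (map_ne_zero τ').mpr ha
      positivity
    exact mul_neg_of_neg_of_pos hneg hτa

/-- **Off the place of `ι₁` Liu's form is `τ'`-positive on every non-zero vector** (tree `posDef_of_ne`). [folklore] -/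
theorem re_embedding_liuForm_pos_of_mk_ne {τ' : L →+* ℂ} (hτ' : InfinitePlace.mk τ' ≠ InfinitePlace.mk ι₁)
    {x : Fin 3 → L} (hx : x ≠ 0) : 0 < (τ' (V.liuForm x x)).re := by
  rw [embedding_liuForm]
  have hx' : (τ' ∘ x : Fin 3 → ℂ) ≠ 0 := by
    intro h
    apply hx
    funext i
    have := congrFun h i
    exact (map_eq_zero τ').mp (by simpa using this)
  exact (V.posDef_of_ne τ' hτ').re_dotProduct_pos hx'

/-! ### §3.4  Liu's signature `(p_τ, q_τ)` of the tree's `V` -/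

/-- **`sig_{τ₁}(V) = (2, 1)`**: typer 1's subspace-counting signature (`HermSpace.sig` = `(posIndex, negIndex)`, the maximal
dimensions of `τ₁`-positive / `τ₁`-negative definite `E`-subspaces, READING R5 of l. 4558) of the tree's hermitian 3-space at the
real place `τ₁ = π(ι₁)`. [cite: Liu2021, App. C l. 4558] -/
theorem toLiu_sig_restr : V.toLiu.sig (restr (maximalRealSubfield L) L ι₁) = (2, 1) := by
  obtain ⟨⟨P, hP2, hPpos⟩, ⟨N, hN1, hNneg⟩⟩ := V.exists_pos_plane_neg_line (τ' := ι₁) rfl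
  have hpos : V.toLiu.posIndex (restr (maximalRealSubfield L) L ι₁) = 2 := by
    apply IsGreatest.csSup_eq
    constructor
    · exact ⟨P, hP2, fun x hx hx0 => (V.toLiu_isPosAt_iff ι₁ x).mpr (hPpos x hx hx0)⟩
    · rintro k ⟨W, rfl, hW⟩
      have h := V.finrank_add_finrank_le_three ι₁ W N
        (fun x hx hx0 => (V.toLiu_isPosAt_iff ι₁ x).mp (hW x hx hx0)) hNneg
      have h2 : Module.finrank L W + Module.finrank L N ≤ 3 := h
      omega
  have hneg : V.toLiu.negIndex (restr (maximalRealSubfield L) L ι₁) = 1 := by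
    apply IsGreatest.csSup_eq
    constructor
    · exact ⟨N, hN1, fun x hx hx0 => (V.toLiu_isNegAt_iff ι₁ x).mpr (hNneg x hx hx0)⟩
    · rintro k ⟨W, rfl, hW⟩
      have h := V.finrank_add_finrank_le_three ι₁ P W hPpos
        (fun x hx hx0 => (V.toLiu_isNegAt_iff ι₁ x).mp (hW x hx hx0))
      have h2 : Module.finrank L P + Module.finrank L W ≤ 3 := h
      omega
  exact Prod.ext hpos hneg

/-- **`sig_τ(V) = (3, 0)` at the real places `τ ≠ τ₁`** (positive definite). [cite: Liu2021, App. C l. 4558] -/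
theorem toLiu_sig_of_ne {τ : maximalRealSubfield L →+* ℝ} (hτ : τ ≠ restr (maximalRealSubfield L) L ι₁) :
    V.toLiu.sig τ = (3, 0) := by
  obtain ⟨τ', hτ'⟩ := CMField.exists_liuRestr_eq τ
  have hne : InfinitePlace.mk τ' ≠ InfinitePlace.mk ι₁ := fun hmk =>
    hτ (hτ'.symm.trans ((CMField.restr_eq_restr_iff_mk_eq ι₁ τ').mpr hmk))
  subst hτ'
  have hpos : V.toLiu.posIndex (restr (maximalRealSubfield L) L τ') = 3 := by
    apply IsGreatest.csSup_eq
    constructor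
    · refine ⟨⊤, ?_, fun x _ hx0 => (V.toLiu_isPosAt_iff τ' x).mpr (V.re_embedding_liuForm_pos_of_mk_ne hne hx0)⟩
      rw [finrank_top]; exact Module.finrank_fin_fun L
    · rintro k ⟨W, rfl, -⟩
      have hle : Module.finrank L W ≤ Module.finrank L (Fin 3 → L) := Submodule.finrank_le _
      rwa [Module.finrank_fin_fun] at hle
  have hneg : V.toLiu.negIndex (restr (maximalRealSubfield L) L τ') = 0 := by
    apply IsGreatest.csSup_eq
    constructor
    · refine ⟨⊥, finrank_bot L _, fun x hx hx0 => ?_⟩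
      exact absurd ((Submodule.mem_bot L).mp hx) hx0
    · rintro k ⟨W, rfl, hW⟩
      have hbot : W = ⊥ := by
        rw [Submodule.eq_bot_iff]
        intro x hx
        by_contra hx0
        exact lt_asymm ((V.toLiu_isNegAt_iff τ' x).mp (hW x hx hx0)) (V.re_embedding_liuForm_pos_of_mk_ne hne hx0)
      rw [hbot, finrank_bot]
  exact Prod.ext hpos hneg

/-- **Remark C.2's hypothesis for the tree's `V`** (typer 1's `HermSpace.IsSignatureN1At`, l. 4603: «`V` has signature
`(n−1, 1)` at `τ` and `(n, 0)` at other places», `n = 3`, `τ = τ₁ = π(ι₁)`) — the REAL hypothesis field `sig_eq` of typer 1's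
carrier structure `HermSpace.ShimuraSystem V.toLiu ι₁` for Liu's `{Sh(G, h_{V,ι₁})_K}_K`. [cite: Liu2021, Rem. C.2 (l. 4603)] -/
theorem toLiu_isSignatureN1At : V.toLiu.IsSignatureN1At (restr (maximalRealSubfield L) L ι₁) :=
  ⟨V.toLiu_sig_restr, fun _ hτ₀ => V.toLiu_sig_of_ne hτ₀⟩

end HermSpace3

end Summit.HodgeConjecture.CorCM

end
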